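import Summits.AtomisticToContinuum.Crystallization.Theorems.ChartedZeroExcessLayeredLatticeLiouvilleUX

/-!
# Zero-excess layered lattice Liouville — part UY (lens-2 g57, node «CaccioppoliZ»): the DISCRETE CACCIOPPOLI INEQUALITY for
truncated-harmonic lattice fields under the GLOBAL coercivity certificate — the first brick of (LD) `LinearExcessDecayZ`.

No statement of the column is re-typed; nothing here is an item.  What is proved (configuration-free, chart-free; all constants explicit):

* UY.1 `norm_layeredKernel_le` — EVERY bond of a `c`-co-Lipschitz layered crystal has force constant `‖K_{XY}‖ ≤ F(c)·N(Y − X)⁻⁸`,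
  `F(c) := (15c⁻⁶ + 9)c⁻⁸` (UV.1's computation without the `|e| ≥ 9/10` restriction: `‖forceConst e‖ ≤ 15|e|⁻¹⁴ + 9|e|⁻⁸`, and `|e| ≥ c·N ≥ c`).
* UY.2 `nearFam_smul_eq` — the DISCRETE PRODUCT RULE behind every Caccioppoli inequality, valid bond by bond for a SELF-ADJOINT bond operator `k`
  (`layeredKernel_selfAdj`, part E) and WITHOUT any sign of `k`:
  `⟪ζ_Y φ_Y − ζ_X φ_X, k(ζ_Y φ_Y − ζ_X φ_X)⟫ = ⟪k(φ_Y − φ_X), ζ_Y² φ_Y − ζ_X² φ_X⟫ + (ζ_Y − ζ_X)²·⟪k φ_X, φ_Y⟫`.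
* UY.3 `truncForm_smul_eq` — summed over the near pairs, the first term is `−2·Σ_{X ∈ P} ⟪truncResidual φ X, ζ_X² φ_X⟫` (bond reversal, UU.1), which
  VANISHES when `φ` is `ϱ`-truncated-harmonic on `P ⊇ supp ζ`; the commutator is `≤ 54·F(c)·L²·Σ_{X ∈ P_ϱ} ‖φ_X‖²` for `L`-Lipschitz `ζ`
  (`sum_commFam_le`: kernel moment `Σ_Y dist(X,Y)²‖K_{XY}‖ ≤ 54 F(c)` by UV.2's shell sum).
* UY.4 ★ `caccioppoliZ` — with the coercivity of the truncated form (UT `truncForm_coercive`, the tail discharged by (T) = UW at `ε := κ₀`):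
  `κ₀ · nnFormZ (ζ • φ) ≤ 54·F(c)·L² · Σ_{X ∈ nearSet P} ‖φ_X‖²` for every `φ` truncated-harmonic on the finite set `P`, every `ζ` supported in `P`
  with `|ζ_Y − ζ_X| ≤ L·dist X Y`, every `ϱ ≥ ϱ_C(c, κ₀) := max 1 (20520/(κ₀c⁷))`; `caccioppoliZ_sub_const` subtracts a free constant.
  This is [giaquinta1984 Ch. III, Prop. 2.1 / (2.2)] for the lattice system: GLOBAL stability (`CoerciveZ`) replaces ellipticity of the
  coefficients — the per-bond blocks `forceConst e` are indefinite for stretched bonds, which is why the product rule UY.2 (no sign needed on the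
  commutator's `k`) and not Young's inequality per bond is used.  [corpus:arxiv-1306.5334 §3] (EOS16) obtain the same interior estimate for Bravais
  lattices through the lattice Green's function; here the laminate is arbitrary (aperiodic stacking allowed) because only `CoerciveZ` enters.
-/

noncomputable section

open scoped BigOperators InnerProductSpace RealInnerProductSpace
open MeasureTheory Set Metric Filter Topology
open Summit.AtomisticToContinuum.Crystallization.Theorems.ChartedPlanarOrderRigidityDoor (E3 IsNash atomsIn)
open Summit.AtomisticToContinuum.Crystallization.Theorems.ChartedPlanarOrderDensityDichotomy (μS IsSep nK nK_nonneg)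
open Summit.AtomisticToContinuum.Crystallization.Theorems.ChartedPlanarOrderDoorLayered (Layered layeredHom_eq_layered)

namespace Summit.AtomisticToContinuum.Crystallization.Theorems.ChartedZeroExcessLayeredLatticeLiouville

section CaccioppoliZ

variable {c : ℝ} {a b : E3} {w : ℤ → E3}

/-! ### UY.1  Force constants of ALL bonds of a co-Lipschitz crystal -/

/-- `‖forceConst e‖ ≤ 15|e|⁻¹⁴ + 9|e|⁻⁸` for every `e ≠ 0` (UV.1's computation before the `|e| ≥ 9/10` specialisation). [folklore] -/
theorem norm_forceConst_le_of_pos {e : E3} (hw0 : 0 < ‖e‖) : ‖forceConst e‖ ≤ 15 * (‖e‖⁻¹) ^ 14 + 9 * (‖e‖⁻¹) ^ 8 := by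
  set u : ℝ := ‖e‖⁻¹ with hu
  have hu0 : 0 < u := inv_pos.2 hw0
  have huw : u * ‖e‖ = 1 := inv_mul_cancel₀ hw0.ne'
  have hx : (‖e‖ ^ 2)⁻¹ = u ^ 2 := by rw [hu, inv_pow]
  have h1 : ‖(-((‖e‖ ^ 2)⁻¹) ^ 7 + ((‖e‖ ^ 2)⁻¹) ^ 4) • ContinuousLinearMap.id ℝ E3‖ ≤ u ^ 14 + u ^ 8 := by
    rw [hx, norm_smul, Real.norm_eq_abs]
    have ha : |-(u ^ 2) ^ 7 + (u ^ 2) ^ 4| ≤ u ^ 14 + u ^ 8 := by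
      rw [show (u ^ 2) ^ 7 = u ^ 14 by ring, show (u ^ 2) ^ 4 = u ^ 8 by ring]
      exact abs_le.2 ⟨by nlinarith [pow_nonneg hu0.le 14, pow_nonneg hu0.le 8],
        by nlinarith [pow_nonneg hu0.le 14, pow_nonneg hu0.le 8]⟩
    calc |-(u ^ 2) ^ 7 + (u ^ 2) ^ 4| * ‖ContinuousLinearMap.id ℝ E3‖
        ≤ (u ^ 14 + u ^ 8) * 1 :=
          mul_le_mul ha ContinuousLinearMap.norm_id_le (norm_nonneg _) (by positivity)
      _ = u ^ 14 + u ^ 8 := mul_one _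
  have h2 : ‖(2 * (7 * ((‖e‖ ^ 2)⁻¹) ^ 8 - 4 * ((‖e‖ ^ 2)⁻¹) ^ 5)) • InnerProductSpace.rankOne ℝ e e‖ ≤
      14 * u ^ 14 + 8 * u ^ 8 := by
    rw [hx, norm_smul, Real.norm_eq_abs, InnerProductSpace.norm_rankOne]
    have ha : |2 * (7 * (u ^ 2) ^ 8 - 4 * (u ^ 2) ^ 5)| ≤ 14 * u ^ 16 + 8 * u ^ 10 := by
      rw [show (u ^ 2) ^ 8 = u ^ 16 by ring, show (u ^ 2) ^ 5 = u ^ 10 by ring]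
      exact abs_le.2 ⟨by nlinarith [pow_nonneg hu0.le 16, pow_nonneg hu0.le 10],
        by nlinarith [pow_nonneg hu0.le 16, pow_nonneg hu0.le 10]⟩
    calc |2 * (7 * (u ^ 2) ^ 8 - 4 * (u ^ 2) ^ 5)| * (‖e‖ * ‖e‖)
        ≤ (14 * u ^ 16 + 8 * u ^ 10) * (‖e‖ * ‖e‖) :=
          mul_le_mul_of_nonneg_right ha (by positivity)
      _ = (14 * u ^ 14 + 8 * u ^ 8) * (u * ‖e‖) ^ 2 := by ring
      _ = 14 * u ^ 14 + 8 * u ^ 8 := by rw [huw, one_pow, mul_one]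
  calc ‖forceConst e‖ ≤ (u ^ 14 + u ^ 8) + (14 * u ^ 14 + 8 * u ^ 8) := norm_add_le_of_le h1 h2
    _ = 15 * u ^ 14 + 9 * u ^ 8 := by ring

/-- the force-constant size function `F(c) = (15c⁻⁶ + 9)c⁻⁸` of a `c`-co-Lipschitz crystal. [this file, g57] -/
def kernelConst (c : ℝ) : ℝ := (15 * (c⁻¹) ^ 6 + 9) * (c⁻¹) ^ 8

/-- Auxiliary step (`kernelConst nonneg`). [formal bookkeeping] -/
theorem kernelConst_nonneg (hc : 0 < c) : 0 ≤ kernelConst c := by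
  unfold kernelConst; positivity

/-- ★ EVERY bond of a `c`-co-Lipschitz layered crystal: `‖K_{XY}‖ ≤ F(c)·N(Y − X)⁻⁸` (the diagonal `X = Y` included: both sides vanish). [this file, g57] -/
theorem norm_layeredKernel_le (hc : 0 < c) (hL : IsLayeredCrystal c a b w) (X Y : Cell 2 × ℤ) :
    ‖layeredKernel a b w (Y.1 - X.1) X.2 Y.2‖ ≤ kernelConst c * (((idxNorm (Y - X) : ℝ))⁻¹) ^ 8 := by
  rw [layeredKernel_sub_fst_eq]
  by_cases hXY : Y = X
  · subst hXY
    rw [if_pos rfl, norm_zero]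
    exact mul_nonneg (kernelConst_nonneg hc) (by positivity)
  · rw [if_neg hXY]
    have hN1 : (1 : ℝ) ≤ (idxNorm (Y - X) : ℝ) := by exact_mod_cast idxNorm_pos (sub_ne_zero.mpr hXY)
    have hN0 : (0 : ℝ) < (idxNorm (Y - X) : ℝ) := by linarith
    have he : c * (idxNorm (Y - X) : ℝ) ≤ ‖lsite a b w Y.1 Y.2 - lsite a b w X.1 X.2‖ :=
      (mul_le_mul_of_nonneg_left (idxNorm_le_dist X Y) hc.le).trans (by rw [norm_sub_rev]; exact hL X Y)
    have hcN : 0 < c * (idxNorm (Y - X) : ℝ) := mul_pos hc hN0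
    have he0 : 0 < ‖lsite a b w Y.1 Y.2 - lsite a b w X.1 X.2‖ := hcN.trans_le he
    have hu : ‖lsite a b w Y.1 Y.2 - lsite a b w X.1 X.2‖⁻¹ ≤ c⁻¹ * ((idxNorm (Y - X) : ℝ))⁻¹ := by
      rw [← mul_inv]; exact inv_anti₀ hcN he
    have hu0 : 0 ≤ ‖lsite a b w Y.1 Y.2 - lsite a b w X.1 X.2‖⁻¹ := inv_nonneg.mpr (norm_nonneg _)
    have hNi1 : ((idxNorm (Y - X) : ℝ))⁻¹ ≤ 1 := inv_le_one_of_one_le₀ hN1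
    have hNi0 : 0 ≤ ((idxNorm (Y - X) : ℝ))⁻¹ := inv_nonneg.mpr hN0.le
    have hci0 : 0 ≤ c⁻¹ := inv_nonneg.mpr hc.le
    refine (norm_forceConst_le_of_pos he0).trans ?_
    have h14 : ‖lsite a b w Y.1 Y.2 - lsite a b w X.1 X.2‖⁻¹ ^ 14 ≤ (c⁻¹) ^ 14 * (((idxNorm (Y - X) : ℝ))⁻¹) ^ 8 := by
      calc ‖lsite a b w Y.1 Y.2 - lsite a b w X.1 X.2‖⁻¹ ^ 14 ≤ (c⁻¹ * ((idxNorm (Y - X) : ℝ))⁻¹) ^ 14 :=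
            pow_le_pow_left₀ hu0 hu 14
        _ = (c⁻¹) ^ 14 * ((((idxNorm (Y - X) : ℝ))⁻¹) ^ 6 * (((idxNorm (Y - X) : ℝ))⁻¹) ^ 8) := by ring
        _ ≤ (c⁻¹) ^ 14 * (1 * (((idxNorm (Y - X) : ℝ))⁻¹) ^ 8) := by
            gcongr
            exact pow_le_one₀ hNi0 hNi1
        _ = (c⁻¹) ^ 14 * (((idxNorm (Y - X) : ℝ))⁻¹) ^ 8 := by rw [one_mul]
    have h8 : ‖lsite a b w Y.1 Y.2 - lsite a b w X.1 X.2‖⁻¹ ^ 8 ≤ (c⁻¹) ^ 8 * (((idxNorm (Y - X) : ℝ))⁻¹) ^ 8 := by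
      calc ‖lsite a b w Y.1 Y.2 - lsite a b w X.1 X.2‖⁻¹ ^ 8 ≤ (c⁻¹ * ((idxNorm (Y - X) : ℝ))⁻¹) ^ 8 := pow_le_pow_left₀ hu0 hu 8
        _ = (c⁻¹) ^ 8 * (((idxNorm (Y - X) : ℝ))⁻¹) ^ 8 := by ring
    calc 15 * ‖lsite a b w Y.1 Y.2 - lsite a b w X.1 X.2‖⁻¹ ^ 14 + 9 * ‖lsite a b w Y.1 Y.2 - lsite a b w X.1 X.2‖⁻¹ ^ 8
        ≤ 15 * ((c⁻¹) ^ 14 * (((idxNorm (Y - X) : ℝ))⁻¹) ^ 8) + 9 * ((c⁻¹) ^ 8 * (((idxNorm (Y - X) : ℝ))⁻¹) ^ 8) := by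
          gcongr
      _ = kernelConst c * (((idxNorm (Y - X) : ℝ))⁻¹) ^ 8 := by unfold kernelConst; ring

/-- the truncated kernel is dominated by the full one. [this file, g57] -/
theorem norm_nearK_le (ϱ : ℝ) (a b : E3) (w : ℤ → E3) (X Y : Cell 2 × ℤ) (u : E3) :
    ‖nearK ϱ a b w X Y u‖ ≤ ‖layeredKernel a b w (Y.1 - X.1) X.2 Y.2‖ * ‖u‖ := by
  unfold nearK
  split_ifs
  · rw [norm_zero]; positivity
  · exact ContinuousLinearMap.le_opNorm _ _

/-- the index distance is the index sup-norm of the displacement (with UV.2's `idxNorm_le_dist`: equality). [this file, g57] -/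
theorem dist_le_idxNorm (X Y : Cell 2 × ℤ) : dist X Y ≤ (idxNorm (Y - X) : ℝ) := by
  rw [Prod.dist_eq]
  refine max_le ?_ ?_
  · refine (dist_pi_le_iff (Nat.cast_nonneg _)).mpr fun j => ?_
    rw [Int.dist_eq, abs_sub_comm, ← Int.cast_sub, ← Int.cast_abs, ← Nat.cast_natAbs]
    exact_mod_cast natAbs_fst_le_idxNorm (Y - X) j
  · rw [Int.dist_eq, abs_sub_comm, ← Int.cast_sub, ← Int.cast_abs, ← Nat.cast_natAbs]
    exact_mod_cast natAbs_snd_le_idxNorm (Y - X)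

/-- Auxiliary step (`idxNorm neg`). [formal bookkeeping] -/
theorem idxNorm_neg (v : Cell 2 × ℤ) : idxNorm (-v) = idxNorm v := by
  simp [idxNorm, Int.natAbs_neg]

/-! ### UY.2  Self-adjointness of the truncated kernel and the discrete product rule -/

/-- the truncated bond operator is self-adjoint (part E `layeredKernel_selfAdj`). [this file, g57] -/
theorem nearK_inner_symm (ϱ : ℝ) (a b : E3) (w : ℤ → E3) (X Y : Cell 2 × ℤ) (u v : E3) :
    ⟪nearK ϱ a b w X Y u, v⟫_ℝ = ⟪u, nearK ϱ a b w X Y v⟫_ℝ := by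
  unfold nearK
  split_ifs
  · rw [inner_zero_left, inner_zero_right]
  · exact layeredKernel_selfAdj a b w _ _ _ u v

/-- Auxiliary step (`nearK sub`). [formal bookkeeping] -/
theorem nearK_sub (ϱ : ℝ) (a b : E3) (w : ℤ → E3) (X Y : Cell 2 × ℤ) (u v : E3) :
    nearK ϱ a b w X Y (u - v) = nearK ϱ a b w X Y u - nearK ϱ a b w X Y v := by
  rw [sub_eq_add_neg, nearK_add, nearK_neg, ← sub_eq_add_neg]

/-- ★ THE DISCRETE PRODUCT RULE (bond by bond, no sign of the bond operator needed):
`⟪t q − s p, k(t q − s p)⟫ = ⟪k(q − p), t² q − s² p⟫ + (t − s)²·⟪k p, q⟫` for the self-adjoint `k = nearK X Y`. [this file, g57] -/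
theorem inner_nearK_smul_sub_smul (ϱ : ℝ) (a b : E3) (w : ℤ → E3) (X Y : Cell 2 × ℤ) (s t : ℝ) (p q : E3) :
    ⟪t • q - s • p, nearK ϱ a b w X Y (t • q - s • p)⟫_ℝ =
      ⟪nearK ϱ a b w X Y (q - p), t ^ 2 • q - s ^ 2 • p⟫_ℝ + (t - s) ^ 2 * ⟪nearK ϱ a b w X Y p, q⟫_ℝ := by
  have e1 : ⟪q, nearK ϱ a b w X Y p⟫_ℝ = ⟪p, nearK ϱ a b w X Y q⟫_ℝ := by
    rw [← nearK_inner_symm, real_inner_comm]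
  have e2 : ⟪nearK ϱ a b w X Y q, p⟫_ℝ = ⟪p, nearK ϱ a b w X Y q⟫_ℝ := real_inner_comm _ _
  have e3 : ⟪nearK ϱ a b w X Y p, q⟫_ℝ = ⟪p, nearK ϱ a b w X Y q⟫_ℝ := nearK_inner_symm ϱ a b w X Y p q
  have e4 : ⟪nearK ϱ a b w X Y q, q⟫_ℝ = ⟪q, nearK ϱ a b w X Y q⟫_ℝ := real_inner_comm _ _
  have e5 : ⟪nearK ϱ a b w X Y p, p⟫_ℝ = ⟪p, nearK ϱ a b w X Y p⟫_ℝ := real_inner_comm _ _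
  rw [nearK_sub ϱ a b w X Y (t • q) (s • p), nearK_smul, nearK_smul, nearK_sub]
  simp only [inner_sub_left, inner_sub_right, real_inner_smul_left, real_inner_smul_right]
  rw [e1, e2, e3, e4, e5]
  ring

/-- the product rule for FIELDS: with `ψ := ζ • φ`, `η := ζ² • φ`, bond by bond. [this file, g57] -/
theorem nearFam_smul_eq (ϱ : ℝ) (a b : E3) (w : ℤ → E3) (ζ : Cell 2 × ℤ → ℝ) (φ : Cell 2 → ℤ → E3)
    (x : (Cell 2 × ℤ) × (Cell 2 × ℤ)) :
    nearFam ϱ a b w (fun γ α => ζ (γ, α) • φ γ α) x =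
      ⟪nearK ϱ a b w x.1 x.2 (φ x.2.1 x.2.2 - φ x.1.1 x.1.2),
          ζ x.2 ^ 2 • φ x.2.1 x.2.2 - ζ x.1 ^ 2 • φ x.1.1 x.1.2⟫_ℝ +
        (ζ x.2 - ζ x.1) ^ 2 * ⟪nearK ϱ a b w x.1 x.2 (φ x.1.1 x.1.2), φ x.2.1 x.2.2⟫_ℝ := by
  unfold nearFam
  exact inner_nearK_smul_sub_smul ϱ a b w x.1 x.2 (ζ x.1) (ζ x.2) (φ x.1.1 x.1.2) (φ x.2.1 x.2.2)

/-- the cut field `ζ • φ`. [this file, g57] -/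
def cutField (ζ : Cell 2 × ℤ → ℝ) (φ : Cell 2 → ℤ → E3) : Cell 2 → ℤ → E3 := fun γ α => ζ (γ, α) • φ γ α

/-- Auxiliary step (`cutField apply`). [formal bookkeeping] -/
theorem cutField_apply (ζ : Cell 2 × ℤ → ℝ) (φ : Cell 2 → ℤ → E3) (X : Cell 2 × ℤ) :
    cutField ζ φ X.1 X.2 = ζ X • φ X.1 X.2 := rfl

/-- Auxiliary step (`cutField eq zero`). [formal bookkeeping] -/
theorem cutField_eq_zero {ζ : Cell 2 × ℤ → ℝ} {P : Finset (Cell 2 × ℤ)} (hζP : ∀ X : Cell 2 × ℤ, X ∉ P → ζ X = 0)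
    (φ : Cell 2 → ℤ → E3) : ∀ X : Cell 2 × ℤ, X ∉ P → cutField ζ φ X.1 X.2 = 0 := fun X hX => by
  rw [cutField_apply, hζP X hX, zero_smul]

/-! ### UY.3  Summing the product rule over the near pairs: the harmonic term vanishes, the commutator is a kernel moment -/

/-- bond reversal: `Σ_X Σ_Y ⟪k_{XY}(φ_Y − φ_X), η_Y⟫ = −Σ_X Σ_Y ⟪k_{XY}(φ_Y − φ_X), η_X⟫` (as UU.1). [this file, g57] -/
theorem sum_sum_inner_nearK_swap (ϱ : ℝ) (a b : E3) (w : ℤ → E3) (N : Finset (Cell 2 × ℤ)) (φ : Cell 2 → ℤ → E3)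
    (η : Cell 2 × ℤ → E3) :
    ∑ X ∈ N, ∑ Y ∈ N, ⟪nearK ϱ a b w X Y (φ Y.1 Y.2 - φ X.1 X.2), η Y⟫_ℝ =
      -∑ X ∈ N, ∑ Y ∈ N, ⟪nearK ϱ a b w X Y (φ Y.1 Y.2 - φ X.1 X.2), η X⟫_ℝ := by
  conv_lhs => rw [Finset.sum_comm]
  rw [← Finset.sum_neg_distrib]
  refine Finset.sum_congr rfl fun p _ => ?_
  rw [← Finset.sum_neg_distrib]
  refine Finset.sum_congr rfl fun q _ => ?_
  rw [nearK_comm ϱ a b w p q, ← neg_sub (φ q.1 q.2) (φ p.1 p.2), nearK_neg, inner_neg_left]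

/-- ★ the HARMONIC TERM VANISHES: for `φ` `ϱ`-truncated-harmonic on `P` and `ζ` supported in `P`,
`Σ_{near pairs} ⟪k_{XY}(φ_Y − φ_X), ζ_Y² φ_Y − ζ_X² φ_X⟫ = −2 Σ_{X ∈ P} ⟪truncResidual φ X, ζ_X² φ_X⟫ = 0`. [this file, g57] -/
theorem sum_harmonicTerm_eq_zero (hc : 0 < c) (hL : IsLayeredCrystal c a b w) {ϱ : ℝ} {P : Finset (Cell 2 × ℤ)}
    {φ : Cell 2 → ℤ → E3} (hφ : IsTruncHarmonicZ ϱ a b w φ ↑P) {ζ : Cell 2 × ℤ → ℝ} (hζP : ∀ X : Cell 2 × ℤ, X ∉ P → ζ X = 0) :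
    ∑ x ∈ nearSet hc hL ϱ P ×ˢ nearSet hc hL ϱ P,
      ⟪nearK ϱ a b w x.1 x.2 (φ x.2.1 x.2.2 - φ x.1.1 x.1.2), ζ x.2 ^ 2 • φ x.2.1 x.2.2 - ζ x.1 ^ 2 • φ x.1.1 x.1.2⟫_ℝ = 0 := by
  have hB : ∀ X ∈ nearSet hc hL ϱ P,
      ∑ Y ∈ nearSet hc hL ϱ P, ⟪nearK ϱ a b w X Y (φ Y.1 Y.2 - φ X.1 X.2), ζ X ^ 2 • φ X.1 X.2⟫_ℝ = 0 := by
    intro X _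
    rw [← sum_inner]
    by_cases hXP : X ∈ P
    · rw [← truncResidual_eq_sum_nearK (fun Y hY => mem_nearSet_of hc hL hXP hY) φ,
        truncResidual_eq_zero_of_isTruncHarmonicZ hφ (Finset.mem_coe.mpr hXP), inner_zero_left]
    · rw [hζP X hXP, sq, mul_zero, zero_smul, inner_zero_right]
  have hsplit : ∀ X ∈ nearSet hc hL ϱ P,
      ∑ Y ∈ nearSet hc hL ϱ P, ⟪nearK ϱ a b w X Y (φ Y.1 Y.2 - φ X.1 X.2), ζ Y ^ 2 • φ Y.1 Y.2 - ζ X ^ 2 • φ X.1 X.2⟫_ℝ =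
        ∑ Y ∈ nearSet hc hL ϱ P, ⟪nearK ϱ a b w X Y (φ Y.1 Y.2 - φ X.1 X.2), ζ Y ^ 2 • φ Y.1 Y.2⟫_ℝ -
          ∑ Y ∈ nearSet hc hL ϱ P, ⟪nearK ϱ a b w X Y (φ Y.1 Y.2 - φ X.1 X.2), ζ X ^ 2 • φ X.1 X.2⟫_ℝ := by
    intro X _
    rw [← Finset.sum_sub_distrib]
    exact Finset.sum_congr rfl fun Y _ => inner_sub_right _ _ _
  rw [Finset.sum_product, Finset.sum_congr rfl hsplit, Finset.sum_sub_distrib,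
    sum_sum_inner_nearK_swap ϱ a b w (nearSet hc hL ϱ P) φ (fun X => ζ X ^ 2 • φ X.1 X.2), Finset.sum_congr rfl hB,
    Finset.sum_const_zero, neg_zero, sub_zero]

/-- the shell weight of UV.2 (`Σ ≤ 54` over every finset), shifted to an arbitrary centre. [this file, g57] -/
theorem sum_idxWeight_shift_le (N : Finset (Cell 2 × ℤ)) (X : Cell 2 × ℤ) :
    ∑ Y ∈ N, (((idxNorm (Y - X) : ℝ)) ^ 7)⁻¹ * (idxNorm (Y - X) : ℝ) ^ 2 ≤ 54 := by
  classical
  have hinj : Set.InjOn (fun Y : Cell 2 × ℤ => Y - X) ↑N := fun Y _ Y' _ h => sub_left_injective h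
  rw [← Finset.sum_image (f := fun v : Cell 2 × ℤ => (((idxNorm v : ℝ)) ^ 7)⁻¹ * (idxNorm v : ℝ) ^ 2) hinj]
  exact sum_idxWeight_le _

/-- Auxiliary step (shifted index-weight sum bound, primed form). [formal bookkeeping] -/
theorem sum_idxWeight_shift_le' (N : Finset (Cell 2 × ℤ)) (Y : Cell 2 × ℤ) :
    ∑ X ∈ N, (((idxNorm (Y - X) : ℝ)) ^ 7)⁻¹ * (idxNorm (Y - X) : ℝ) ^ 2 ≤ 54 := by
  have h : ∀ X : Cell 2 × ℤ, idxNorm (Y - X) = idxNorm (X - Y) := fun X => by rw [← neg_sub, idxNorm_neg]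
  simp_rw [h]
  exact sum_idxWeight_shift_le N Y

/-- the geometric factor of the commutator: `dist(X,Y)² · N(Y−X)⁻⁸ ≤ N⁻⁷·N²` (both sides vanish on the diagonal). [this file, g57] -/
theorem dist_sq_mul_inv_pow_le (X Y : Cell 2 × ℤ) :
    dist X Y ^ 2 * (((idxNorm (Y - X) : ℝ))⁻¹) ^ 8 ≤ (((idxNorm (Y - X) : ℝ)) ^ 7)⁻¹ * (idxNorm (Y - X) : ℝ) ^ 2 := by
  rcases Nat.eq_zero_or_pos (idxNorm (Y - X)) with h0 | hpos
  · rw [h0]; simp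
  · have hN1 : (1 : ℝ) ≤ (idxNorm (Y - X) : ℝ) := by exact_mod_cast hpos
    have hN0 : (0 : ℝ) < (idxNorm (Y - X) : ℝ) := by linarith
    have hd : dist X Y ^ 2 ≤ (idxNorm (Y - X) : ℝ) ^ 2 := pow_le_pow_left₀ dist_nonneg (dist_le_idxNorm X Y) 2
    calc dist X Y ^ 2 * (((idxNorm (Y - X) : ℝ))⁻¹) ^ 8 ≤ (idxNorm (Y - X) : ℝ) ^ 2 * (((idxNorm (Y - X) : ℝ))⁻¹) ^ 8 :=
          mul_le_mul_of_nonneg_right hd (by positivity)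
      _ = (((idxNorm (Y - X) : ℝ))⁻¹) ^ 6 := by field_simp
      _ ≤ (((idxNorm (Y - X) : ℝ))⁻¹) ^ 5 :=
          pow_le_pow_of_le_one (inv_nonneg.mpr hN0.le) (inv_le_one_of_one_le₀ hN1) (by norm_num)
      _ = (((idxNorm (Y - X) : ℝ)) ^ 7)⁻¹ * (idxNorm (Y - X) : ℝ) ^ 2 := by field_simp

/-- one commutator term. [this file, g57] -/
theorem commTerm_le (hc : 0 < c) (hL : IsLayeredCrystal c a b w) (ϱ : ℝ) {ζ : Cell 2 × ℤ → ℝ} {L : ℝ}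
    (hζL : ∀ X Y : Cell 2 × ℤ, |ζ Y - ζ X| ≤ L * dist X Y) (φ : Cell 2 → ℤ → E3) (x : (Cell 2 × ℤ) × (Cell 2 × ℤ)) :
    (ζ x.2 - ζ x.1) ^ 2 * ⟪nearK ϱ a b w x.1 x.2 (φ x.1.1 x.1.2), φ x.2.1 x.2.2⟫_ℝ ≤
      L ^ 2 * kernelConst c / 2 * (((((idxNorm (x.2 - x.1) : ℝ)) ^ 7)⁻¹ * (idxNorm (x.2 - x.1) : ℝ) ^ 2) *
        (‖φ x.1.1 x.1.2‖ ^ 2 + ‖φ x.2.1 x.2.2‖ ^ 2)) := by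
  have hF := kernelConst_nonneg hc
  have h1 : (ζ x.2 - ζ x.1) ^ 2 ≤ L ^ 2 * dist x.1 x.2 ^ 2 := by
    rw [← sq_abs, ← mul_pow]
    exact pow_le_pow_left₀ (abs_nonneg _) (hζL x.1 x.2) 2
  have h2 : ⟪nearK ϱ a b w x.1 x.2 (φ x.1.1 x.1.2), φ x.2.1 x.2.2⟫_ℝ ≤
      kernelConst c * (((idxNorm (x.2 - x.1) : ℝ))⁻¹) ^ 8 * (‖φ x.1.1 x.1.2‖ * ‖φ x.2.1 x.2.2‖) := by
    refine (real_inner_le_norm _ _).trans ?_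
    calc ‖nearK ϱ a b w x.1 x.2 (φ x.1.1 x.1.2)‖ * ‖φ x.2.1 x.2.2‖
        ≤ ‖layeredKernel a b w (x.2.1 - x.1.1) x.1.2 x.2.2‖ * ‖φ x.1.1 x.1.2‖ * ‖φ x.2.1 x.2.2‖ :=
          mul_le_mul_of_nonneg_right (norm_nearK_le ϱ a b w x.1 x.2 _) (norm_nonneg _)
      _ ≤ kernelConst c * (((idxNorm (x.2 - x.1) : ℝ))⁻¹) ^ 8 * ‖φ x.1.1 x.1.2‖ * ‖φ x.2.1 x.2.2‖ := by
          gcongr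
          exact norm_layeredKernel_le hc hL x.1 x.2
      _ = kernelConst c * (((idxNorm (x.2 - x.1) : ℝ))⁻¹) ^ 8 * (‖φ x.1.1 x.1.2‖ * ‖φ x.2.1 x.2.2‖) := by ring
  have h3 : ‖φ x.1.1 x.1.2‖ * ‖φ x.2.1 x.2.2‖ ≤ (‖φ x.1.1 x.1.2‖ ^ 2 + ‖φ x.2.1 x.2.2‖ ^ 2) / 2 := by
    nlinarith [sq_nonneg (‖φ x.1.1 x.1.2‖ - ‖φ x.2.1 x.2.2‖)]
  have hw := dist_sq_mul_inv_pow_le x.1 x.2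
  have hK0 : 0 ≤ kernelConst c * (((idxNorm (x.2 - x.1) : ℝ))⁻¹) ^ 8 * (‖φ x.1.1 x.1.2‖ * ‖φ x.2.1 x.2.2‖) := by positivity
  calc (ζ x.2 - ζ x.1) ^ 2 * ⟪nearK ϱ a b w x.1 x.2 (φ x.1.1 x.1.2), φ x.2.1 x.2.2⟫_ℝ
      ≤ (ζ x.2 - ζ x.1) ^ 2 * (kernelConst c * (((idxNorm (x.2 - x.1) : ℝ))⁻¹) ^ 8 * (‖φ x.1.1 x.1.2‖ * ‖φ x.2.1 x.2.2‖)) :=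
        mul_le_mul_of_nonneg_left h2 (sq_nonneg _)
    _ ≤ L ^ 2 * dist x.1 x.2 ^ 2 * (kernelConst c * (((idxNorm (x.2 - x.1) : ℝ))⁻¹) ^ 8 * (‖φ x.1.1 x.1.2‖ * ‖φ x.2.1 x.2.2‖)) :=
        mul_le_mul_of_nonneg_right h1 hK0
    _ = L ^ 2 * kernelConst c * (dist x.1 x.2 ^ 2 * (((idxNorm (x.2 - x.1) : ℝ))⁻¹) ^ 8) * (‖φ x.1.1 x.1.2‖ * ‖φ x.2.1 x.2.2‖) := by
        ring
    _ ≤ L ^ 2 * kernelConst c * ((((idxNorm (x.2 - x.1) : ℝ)) ^ 7)⁻¹ * (idxNorm (x.2 - x.1) : ℝ) ^ 2) *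
          ((‖φ x.1.1 x.1.2‖ ^ 2 + ‖φ x.2.1 x.2.2‖ ^ 2) / 2) :=
        mul_le_mul (mul_le_mul_of_nonneg_left hw (by positivity)) h3 (by positivity) (by positivity)
    _ = L ^ 2 * kernelConst c / 2 * (((((idxNorm (x.2 - x.1) : ℝ)) ^ 7)⁻¹ * (idxNorm (x.2 - x.1) : ℝ) ^ 2) *
        (‖φ x.1.1 x.1.2‖ ^ 2 + ‖φ x.2.1 x.2.2‖ ^ 2)) := by ring

/-- ★ THE COMMUTATOR IS A KERNEL MOMENT: `Σ_{N×N} (ζ_Y − ζ_X)²⟪k_{XY} φ_X, φ_Y⟫ ≤ 54·F(c)·L²·Σ_{X ∈ N} ‖φ_X‖²`. [this file, g57] -/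
theorem sum_commTerm_le (hc : 0 < c) (hL : IsLayeredCrystal c a b w) (ϱ : ℝ) (N : Finset (Cell 2 × ℤ)) {ζ : Cell 2 × ℤ → ℝ} {L : ℝ}
    (hζL : ∀ X Y : Cell 2 × ℤ, |ζ Y - ζ X| ≤ L * dist X Y) (φ : Cell 2 → ℤ → E3) :
    ∑ x ∈ N ×ˢ N, (ζ x.2 - ζ x.1) ^ 2 * ⟪nearK ϱ a b w x.1 x.2 (φ x.1.1 x.1.2), φ x.2.1 x.2.2⟫_ℝ ≤
      54 * kernelConst c * L ^ 2 * ∑ X ∈ N, ‖φ X.1 X.2‖ ^ 2 := by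
  have hF := kernelConst_nonneg hc
  have hrow : ∑ x ∈ N ×ˢ N, (((idxNorm (x.2 - x.1) : ℝ)) ^ 7)⁻¹ * (idxNorm (x.2 - x.1) : ℝ) ^ 2 * ‖φ x.1.1 x.1.2‖ ^ 2 ≤
      54 * ∑ X ∈ N, ‖φ X.1 X.2‖ ^ 2 := by
    rw [Finset.sum_product, Finset.mul_sum]
    refine Finset.sum_le_sum fun X _ => ?_
    calc ∑ Y ∈ N, (((idxNorm (Y - X) : ℝ)) ^ 7)⁻¹ * (idxNorm (Y - X) : ℝ) ^ 2 * ‖φ X.1 X.2‖ ^ 2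
        = (∑ Y ∈ N, (((idxNorm (Y - X) : ℝ)) ^ 7)⁻¹ * (idxNorm (Y - X) : ℝ) ^ 2) * ‖φ X.1 X.2‖ ^ 2 := by
          rw [Finset.sum_mul]
      _ ≤ 54 * ‖φ X.1 X.2‖ ^ 2 := mul_le_mul_of_nonneg_right (sum_idxWeight_shift_le N X) (sq_nonneg _)
  have hcol : ∑ x ∈ N ×ˢ N, (((idxNorm (x.2 - x.1) : ℝ)) ^ 7)⁻¹ * (idxNorm (x.2 - x.1) : ℝ) ^ 2 * ‖φ x.2.1 x.2.2‖ ^ 2 ≤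
      54 * ∑ X ∈ N, ‖φ X.1 X.2‖ ^ 2 := by
    rw [Finset.sum_product_right, Finset.mul_sum]
    refine Finset.sum_le_sum fun Y _ => ?_
    calc ∑ X ∈ N, (((idxNorm (Y - X) : ℝ)) ^ 7)⁻¹ * (idxNorm (Y - X) : ℝ) ^ 2 * ‖φ Y.1 Y.2‖ ^ 2
        = (∑ X ∈ N, (((idxNorm (Y - X) : ℝ)) ^ 7)⁻¹ * (idxNorm (Y - X) : ℝ) ^ 2) * ‖φ Y.1 Y.2‖ ^ 2 := by
          rw [Finset.sum_mul]
      _ ≤ 54 * ‖φ Y.1 Y.2‖ ^ 2 := mul_le_mul_of_nonneg_right (sum_idxWeight_shift_le' N Y) (sq_nonneg _)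
  calc ∑ x ∈ N ×ˢ N, (ζ x.2 - ζ x.1) ^ 2 * ⟪nearK ϱ a b w x.1 x.2 (φ x.1.1 x.1.2), φ x.2.1 x.2.2⟫_ℝ
      ≤ ∑ x ∈ N ×ˢ N, L ^ 2 * kernelConst c / 2 * (((((idxNorm (x.2 - x.1) : ℝ)) ^ 7)⁻¹ * (idxNorm (x.2 - x.1) : ℝ) ^ 2) *
          (‖φ x.1.1 x.1.2‖ ^ 2 + ‖φ x.2.1 x.2.2‖ ^ 2)) := Finset.sum_le_sum fun x _ => commTerm_le hc hL ϱ hζL φ x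
    _ = L ^ 2 * kernelConst c / 2 *
          ((∑ x ∈ N ×ˢ N, (((idxNorm (x.2 - x.1) : ℝ)) ^ 7)⁻¹ * (idxNorm (x.2 - x.1) : ℝ) ^ 2 * ‖φ x.1.1 x.1.2‖ ^ 2) +
            ∑ x ∈ N ×ˢ N, (((idxNorm (x.2 - x.1) : ℝ)) ^ 7)⁻¹ * (idxNorm (x.2 - x.1) : ℝ) ^ 2 * ‖φ x.2.1 x.2.2‖ ^ 2) := by
        rw [← Finset.mul_sum, ← Finset.sum_add_distrib]
        refine congrArg _ (Finset.sum_congr rfl fun x _ => by ring)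
    _ ≤ L ^ 2 * kernelConst c / 2 * (54 * ∑ X ∈ N, ‖φ X.1 X.2‖ ^ 2 + 54 * ∑ X ∈ N, ‖φ X.1 X.2‖ ^ 2) := by
        have h0 : 0 ≤ L ^ 2 * kernelConst c / 2 := by positivity
        exact mul_le_mul_of_nonneg_left (add_le_add hrow hcol) h0
    _ = 54 * kernelConst c * L ^ 2 * ∑ X ∈ N, ‖φ X.1 X.2‖ ^ 2 := by ring

/-! ### UY.4  ★ The Caccioppoli inequality -/

/-- ★★ **DISCRETE CACCIOPPOLI INEQUALITY** for `ϱ`-truncated-harmonic lattice fields under the global coercivity certificate: for `φ` truncated-harmonic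
on the finite set `P`, `ζ` supported in `P` with `|ζ_Y − ζ_X| ≤ L·dist X Y`, and the (T)-tail at range `ϱ` dominated at `ε := κ₀`,
`κ₀ · nnFormZ (ζ • φ) ≤ 54·F(c)·L² · Σ_{X ∈ nearSet P} ‖φ_X‖²`. [giaquinta1984 Ch. III Prop. 2.1, lattice form; this file, g57] -/
theorem caccioppoliZ (hc : 0 < c) (hL : IsLayeredCrystal c a b w) {κ₀ : ℝ} (hK : CoerciveZ (layeredKernel a b w) κ₀) {ϱ : ℝ}
    (hT : ∀ χ : Cell 2 → ℤ → E3, HasFiniteSupport χ → Summable (tailFam ϱ a b w χ) ∧ ∑' x, tailFam ϱ a b w χ x ≤ κ₀ * nnFormZ χ)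
    {P : Finset (Cell 2 × ℤ)} {φ : Cell 2 → ℤ → E3} (hφ : IsTruncHarmonicZ ϱ a b w φ ↑P) {ζ : Cell 2 × ℤ → ℝ} {L : ℝ}
    (hζP : ∀ X : Cell 2 × ℤ, X ∉ P → ζ X = 0) (hζL : ∀ X Y : Cell 2 × ℤ, |ζ Y - ζ X| ≤ L * dist X Y) :
    κ₀ * nnFormZ (cutField ζ φ) ≤ 54 * kernelConst c * L ^ 2 * ∑ X ∈ nearSet hc hL ϱ P, ‖φ X.1 X.2‖ ^ 2 := by
  have hψ := cutField_eq_zero hζP φ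
  have hfs : HasFiniteSupport (cutField ζ φ) := ⟨P, fun γ m h => hψ (γ, m) h⟩
  have hco := truncForm_coercive hc hL hK hψ (hT _ hfs)
  have hsplit : ∑ x ∈ nearSet hc hL ϱ P ×ˢ nearSet hc hL ϱ P, nearFam ϱ a b w (cutField ζ φ) x =
      (∑ x ∈ nearSet hc hL ϱ P ×ˢ nearSet hc hL ϱ P,
        ⟪nearK ϱ a b w x.1 x.2 (φ x.2.1 x.2.2 - φ x.1.1 x.1.2), ζ x.2 ^ 2 • φ x.2.1 x.2.2 - ζ x.1 ^ 2 • φ x.1.1 x.1.2⟫_ℝ) +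
        ∑ x ∈ nearSet hc hL ϱ P ×ˢ nearSet hc hL ϱ P,
          (ζ x.2 - ζ x.1) ^ 2 * ⟪nearK ϱ a b w x.1 x.2 (φ x.1.1 x.1.2), φ x.2.1 x.2.2⟫_ℝ := by
    rw [← Finset.sum_add_distrib]
    exact Finset.sum_congr rfl fun x _ => nearFam_smul_eq ϱ a b w ζ φ x
  rw [hsplit, sum_harmonicTerm_eq_zero hc hL hφ hζP, zero_add] at hco
  have hS2 := sum_commTerm_le hc hL ϱ (nearSet hc hL ϱ P) hζL φ
  linarith

/-- subtracting a constant preserves truncated harmonicity. [this file, g57] -/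
theorem isTruncHarmonicZ_sub_const {ϱ : ℝ} {φ : Cell 2 → ℤ → E3} {P : Set (Cell 2 × ℤ)} (hφ : IsTruncHarmonicZ ϱ a b w φ P) (v : E3) :
    IsTruncHarmonicZ ϱ a b w (fun γ α => φ γ α - v) P := by
  intro X hX
  simpa only [sub_sub_sub_cancel_right] using hφ X hX

/-- ★★ **CACCIOPPOLI, CERTIFIED FORM** ((T) discharged by `tailDominationCert_holds`, a free constant subtracted): for every co-Lipschitz constant `c`
and coercivity constant `κ₀` there is a range `ϱ_C ≥ 1` beyond which every `κ₀`-coercive `c`-co-Lipschitz layered crystal satisfies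
`κ₀ · nnFormZ (ζ • (φ − v)) ≤ 54·F(c)·L² · Σ_{X ∈ nearSet P} ‖φ_X − v‖²` for all `P`, all `φ` truncated-harmonic on `P`, all admissible cut-offs `ζ`
and all constants `v`. [this file, g57] -/
theorem caccioppoliZ_cert (hc : 0 < c) {κ₀ : ℝ} (hκ₀ : 0 < κ₀) :
    ∃ ϱC : ℝ, 1 ≤ ϱC ∧ ∀ ϱ : ℝ, ϱC ≤ ϱ → ∀ (a b : E3) (w : ℤ → E3) (hL : IsLayeredCrystal c a b w),
      CoerciveZ (layeredKernel a b w) κ₀ → ∀ (P : Finset (Cell 2 × ℤ)) (φ : Cell 2 → ℤ → E3), IsTruncHarmonicZ ϱ a b w φ ↑P →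
        ∀ (ζ : Cell 2 × ℤ → ℝ) (L : ℝ), (∀ X : Cell 2 × ℤ, X ∉ P → ζ X = 0) → (∀ X Y : Cell 2 × ℤ, |ζ Y - ζ X| ≤ L * dist X Y) →
          ∀ v : E3, κ₀ * nnFormZ (cutField ζ (fun γ α => φ γ α - v)) ≤
            54 * kernelConst c * L ^ 2 * ∑ X ∈ nearSet hc hL ϱ P, ‖φ X.1 X.2 - v‖ ^ 2 := by
  obtain ⟨ϱ₀, hϱ₀, hT⟩ := tailDominationCert_holds c hc κ₀ hκ₀
  refine ⟨max 1 ϱ₀, le_max_left _ _, fun ϱ hϱ a b w hL hK P φ hφ ζ L hζP hζL v => ?_⟩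
  have hT' : ∀ χ : Cell 2 → ℤ → E3, HasFiniteSupport χ →
      Summable (tailFam ϱ a b w χ) ∧ ∑' x, tailFam ϱ a b w χ x ≤ κ₀ * nnFormZ χ :=
    fun χ hχ => hT ϱ ((le_max_right _ _).trans hϱ) a b w hL χ hχ
  exact caccioppoliZ hc hL hK hT' (isTruncHarmonicZ_sub_const hφ v) hζP hζL

end CaccioppoliZ

end Summit.AtomisticToContinuum.Crystallization.Theorems.ChartedZeroExcessLayeredLatticeLiouville

end
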